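import Literature.AlgebraicGeometry.Modules.BoundedCoherentVBModelsOfRepresentative
import Literature.AlgebraicGeometry.Modules.QcRepresentativeOfSeparated
import HarnessLib

/-!
# Discharge of the named fact `ThomasonTrobaugh_vbModel_of_boundedCoh` ([SP]) on complex abelian varieties

Layer `Literature/AlgebraicGeometry/Modules`. The named fact
`Modules/BoundedCoherentVBModels.ThomasonTrobaugh_vbModel_of_boundedCoh` (Thomason–Trobaugh 2.3.1 (d) ∧
Auslander–Buchsbaum–Serre ∧ SGA 6 II 2.2.2.1 / 3.5, typed on a complex abelian variety `B`: every object of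
`D⁺(Mod 𝒪_B)` with bounded coherent cohomology sheaves is the class `Q⁺⟨K, n⟩` of a bounded complex `K` of finite
locally free `𝒪_B`-modules) is PROVED as the composition of two tree theorems:

* Stage I of the `D⁺_qc` comparison, `Modules/QcRepresentativeOfSeparated.AbelianVariety.exists_qcRepresentative`
  (Görtz–Wedhorn II Lemma 22.36 ∕ Hartshorne RD II Cor. 7.19: a bounded-below QUASI-COHERENT representative), and
* `Modules/BoundedCoherentVBModelsOfRepresentative.AbelianVariety.exists_vbModel_of_qcRepresentative_of_isLE`
  (regularity + the resolution property of the projective `B` + the syzygy theorem: a bounded VECTOR-BUNDLE model of a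
  bounded-below quasi-coherent representative with bounded coherent cohomology),

bridged by `Morphisms/DevissageClass.Coh.loc` (coherent ⇒ affine-localizing). One theorem, no definitions, no instances.

## References

* R. W. Thomason, T. Trobaugh, *Higher algebraic K-theory of schemes and of derived categories* (1990), Prop. 2.3.1 (d),
  Appendix B. [ThomasonTrobaugh1990]
* P. Berthelot, A. Grothendieck, L. Illusie, *SGA 6*, Exp. II, Cor. 2.2.2.1 and Prop. 3.5. [SGA6]
* U. Görtz, T. Wedhorn, *Algebraic Geometry II* (2023), Lemma 22.36, Thm. 22.35. [GortzWedhorn2023]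
* D. Huybrechts, *Fourier–Mukai transforms in algebraic geometry* (2006), Prop. 3.26. [HuybrechtsFM2006]
-/

noncomputable section

universe w

open CategoryTheory AlgebraicGeometry

namespace Literature.AlgebraicGeometry.Modules

/-- **[SP] holds**: on a complex abelian variety, every object of `D⁺(Mod 𝒪_B)` with bounded and coherent cohomology
sheaves is isomorphic to the class of a bounded complex of finite locally free `𝒪_B`-modules — the named fact
`ThomasonTrobaugh_vbModel_of_boundedCoh`, discharged by composing Stage I (`AbelianVariety.exists_qcRepresentative`)
with `AbelianVariety.exists_vbModel_of_qcRepresentative_of_isLE`.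
[cite: ThomasonTrobaugh1990, Prop. 2.3.1 (d) and Appendix B] [cite: SGA6, Exp. II Cor. 2.2.2.1 and Prop. 3.5]
[cite: GortzWedhorn2023, Lemma 22.36 and Thm. 22.35] [cite: HuybrechtsFM2006, Prop. 3.26] -/
theorem ThomasonTrobaugh_vbModel_of_boundedCoh_holds : ThomasonTrobaugh_vbModel_of_boundedCoh.{w} := by
  intro B _ E a b hE hb hcoh
  haveI := hE
  obtain ⟨M, hn, -, hM, ⟨eM⟩⟩ := AbelianVariety.exists_qcRepresentative B E a (fun k => (hcoh k).loc)
  exact AbelianVariety.exists_vbModel_of_qcRepresentative_of_isLE B E a b hE hb hcoh M hn hM eM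

end Literature.AlgebraicGeometry.Modules

end
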